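import Literature.AlgebraicGeometry.HodgeTheory.HodgeGroupExteriorAction
import HarnessLib

/-!
# A Hodge-structure endomorphism of `Hᵏ(X(ℂ); ℂ)` commutes with the Hodge group (helper for crux X3
`CYFormSquarePrinciple` of route `CYFormCasimir`, item stmt-HodgeConjecture-23494)

research route conditional on HC_CM; not a corollary. Nothing here proves HC, HC_CM or any rung.

For a smooth projective `X/ℂ` of dimension `n` and a `ℂ`-linear `P : Hᵏ(X(ℂ); ℂ) → Hᵏ(X(ℂ); ℂ)` that
(i) maps rational classes to rational classes and (ii) preserves Hodge types, every element `g` of the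
tree's Tannaka-free Hodge group `HodgeTheory.hodgeGroup n X` commutes with `P`:
`g_k (P y) = P (g_k y)` (`hodgeGroup_apply_hodgeEndo`). This is the sub-Hodge-structure /
Hodge-endomorphism stability of Deligne–Milne (LNM 900, I §3: morphisms of Hodge structures between
tensor constructions are `MT`-equivariant), run on the tree's carriers exactly as the tree's
`HodgeTheory.hodgeGroup_apply_map` (the case `P = f^*`): the transposed graph-type class
`Σᵢ pr₁^* P xᵢ ∪ pr₂^* xdᵢ` on `X × X` (Voisin I, Lemma 11.41) is a rational `(n,n)`-class, hence fixed by
the Künneth extension of `g`; compare Künneth coefficients (`HodgeGroupExterior.sum_smul_eq_of_sum_cross_eq`,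
`HodgeGroupExterior.cupPairing_apply_dual`). Consequence used by X3: the range of such a `P` is stable
under `g_k` (`hodgeGroup_apply_mem_range_hodgeEndo`).

References: Deligne1982HodgeCycles (I §3), VoisinHodgeI2002 (§11.3.3 Lemma 11.41, §7.3.2 Lemma 7.30),
HatcherAT2002 (§3.2 Thm. 3.16, §3.3 Prop. 3.38).
-/

-- `Summit.HodgeConjecture.HodgeConjecture.…` is the tree's mandated summit/problem namespace (single-problem summit).
set_option linter.dupNamespace false
noncomputable section

open CategoryTheory MonoidalCategory CartesianMonoidalCategory
open Literature.AlgebraicTopology.SingularHomology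
open Literature.AlgebraicGeometry.Motives
open Literature.AlgebraicGeometry.HodgeTheory

namespace Summit.HodgeConjecture.HodgeConjecture.Theorems.CYFormSquare

variable {n : ℕ} {X : SchemeOver ℂ}

/-- **The transposed graph-type class of a Hodge-type-preserving endomorphism is of type `(n, n)`**
(Voisin I, Lemma 11.41 with Lemma 7.30, for an endomorphism `P` of `Hᵏ(X(ℂ); ℂ)` in place of `f^*`):
for a basis `x` of `Hᵏ(X(ℂ); ℂ)` with dual family `xd` for the cup pairing (`k + d = 2 dim X`), the class
`Σᵢ pr₁^* P xᵢ ∪ pr₂^* xdᵢ ∈ H^{2 dim X}((X ⊗ X)(ℂ); ℂ)` is of type `(dim X, dim X)` (in a Hodge-adapted basis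
each summand has type `(p, q) + (dim X - p, dim X - q)`). [cite: VoisinHodgeI2002, §11.3.3 Lemma 11.41 and §7.3.2 Lemma 7.30] -/
theorem graphClassEndo_isOfHodgeType (hX : IsSmoothProjective n X) {k d : ℕ} (hkd : k + d = 2 * n)
    (P : complexBetti X k →ₗ[ℂ] complexBetti X k)
    (hPt : ∀ (p q : ℕ) (y : complexBetti X k), IsOfHodgeType n X k p q y → IsOfHodgeType n X k p q (P y))
    {ι : Type} [Fintype ι] [DecidableEq ι]
    (x : Module.Basis ι ℂ (complexBetti X k)) {xd : ι → complexBetti X d} (μ : OrientationFamily)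
    (hd : ∀ i j, cupPairing (μ hX) hkd (x i) (xd j) = if i = j then 1 else 0) :
    IsOfHodgeType (n + n) (X ⊗ X) (2 * n) n n
      (∑ i, cupProduct hkd (complexBetti.map (fst X X) k (P (x i)))
        (complexBetti.map (snd X X) d (xd i))) := by
  classical
  have hXX := Literature.AlgebraicGeometry.Motives.IsSmoothProjective.tensor_holds hX hX
  have hI := hodgePQ_independent_of_hodgeModel_holds
  obtain ⟨Q⟩ := nonempty_hodgeModel_holds (n := n + n) (X := X ⊗ X) hXX
  obtain ⟨B⟩ := nonempty_hodgeModel_holds (n := n) (X := X) hX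
  -- cup products add Hodge types (the tree's `cupPreservesHodgeType_of_multiplicative_deRham`)
  have hcupX : CupPreservesHodgeType n X := cupPreservesHodgeType_of_multiplicative_deRham
    (fun E _ _ _ ↦ Literature.NumberTheory.Transcendental.exists_deRhamIsoFamily_holds E) hX
  have hcupXX : CupPreservesHodgeType (n + n) (X ⊗ X) := cupPreservesHodgeType_of_multiplicative_deRham
    (fun E _ _ _ ↦ Literature.NumberTheory.Transcendental.exists_deRhamIsoFamily_holds E) hXX
  -- the bilinear map `Φ(u, v) = pr₁^* P u ∪ pr₂^* v`
  let Φ : complexBetti X k →ₗ[ℂ] complexBetti X d →ₗ[ℂ] complexBetti (X ⊗ X) (2 * n) :=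
    ((cupProduct hkd) ∘ₗ ((complexBetti.map (fst X X) k).hom ∘ₗ P)).compl₂ (complexBetti.map (snd X X) d).hom
  have hΦ : ∀ u v, Φ u v = cupProduct hkd (complexBetti.map (fst X X) k (P u))
      (complexBetti.map (snd X X) d v) := fun u v ↦ rfl
  have hγ : (∑ i, cupProduct hkd (complexBetti.map (fst X X) k (P (x i)))
        (complexBetti.map (snd X X) d (xd i))) = ∑ i, Φ (x i) (xd i) := by
    simp_rw [hΦ]
  rw [hγ]
  -- pass to a Hodge-adapted basis of `Hᵏ(X(ℂ))`
  letI := hX.chartedSpace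
  haveI := Literature.AlgebraicGeometry.Motives.ComplexPoints.compactSpace_of_isSmoothProjective hX
  haveI := Literature.AlgebraicGeometry.Motives.ComplexPoints.t2Space_of_isSmoothProjective hX
  haveI : Module.Finite ℂ (complexBetti X k) := finite_complexBetti hX k
  have hint := isInternal_hodgePiece B k
  let v : ∀ pq : ↥(Finset.HasAntidiagonal.antidiagonal k),
      Module.Basis (Fin (Module.finrank ℂ ((B.hodgePQ k pq.1.1 pq.1.2).comap (B.pullback k).hom))) ℂ
        ((B.hodgePQ k pq.1.1 pq.1.2).comap (B.pullback k).hom) :=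
    fun pq ↦ Module.finBasis ℂ _
  set y := hint.collectedBasis v with hy
  obtain ⟨yd, hyd⟩ := PerfPairDuality.exists_dual (isPerfPair_cupPairing_complexPoints μ hX hkd) y
  have hswitch : ∑ i, Φ (x i) (xd i) = ∑ j, Φ (y j) (yd j) :=
    PerfPairDuality.sum_dual_eq_sum_dual (isPerfPair_cupPairing_complexPoints μ hX hkd) x hd y hyd Φ
  rw [hswitch]
  refine ⟨Q, ?_⟩
  rw [map_sum]
  refine Submodule.sum_mem _ fun j _ ↦ (hI.isOfHodgeType_iff hXX Q).1 ?_
  -- the summand `pr₁^* P y_j ∪ pr₂^* yd_j` has type `(n, n)`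
  have hyj : (B.pullback k).hom (y j) ∈ B.hodgePQ k j.1.1.1 j.1.1.2 := hint.collectedBasis_mem v j
  obtain ⟨hpj, hqj⟩ := le_of_pullback_mem_hodgePQ_of_ne_zero B hyj (y.ne_zero j)
  obtain ⟨k', hk'⟩ : ∃ k', k' + j.1.1.1 = n := ⟨n - j.1.1.1, by omega⟩
  obtain ⟨l', hl'⟩ : ∃ l', l' + j.1.1.2 = n := ⟨n - j.1.1.2, by omega⟩
  have hydj : IsOfHodgeType n X d k' l' (yd j) :=
    ⟨B, dual_pullback_mem_hodgePQ μ hX B hcupX hkd v hyd j hk' hl'⟩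
  have hyjX : IsOfHodgeType n X k j.1.1.1 j.1.1.2 (y j) := ⟨B, hyj⟩
  have hPyj : IsOfHodgeType n X k j.1.1.1 j.1.1.2 (P (y j)) := hPt _ _ _ hyjX
  have hx := isOfHodgeType_cupProduct_map_map_of_cupPreservesHodgeType hXX hX hX (fst X X) (snd X X)
    hcupXX hkd hPyj hydj
  rw [show j.1.1.1 + k' = n by omega, show j.1.1.2 + l' = n by omega] at hx
  rw [hΦ]
  exact hx

/-- The transposed graph-type class `Σᵢ pr₁^* P xᵢ ∪ pr₂^* xdᵢ` built on RATIONAL classes `xᵢ`, `xdᵢ`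
is rational when `P` preserves rational classes (pull-backs and cup products of rational classes are
rational). [cite: VoisinHodgeI2002, §11.3.3 Lemma 11.41] -/
theorem graphClassEndo_isRationalClass {k d : ℕ} (hkd : k + d = 2 * n)
    (P : complexBetti X k →ₗ[ℂ] complexBetti X k)
    (hPr : ∀ y : complexBetti X k, IsRationalClass y → IsRationalClass (P y))
    {ι : Type} [Fintype ι]
    {x : ι → complexBetti X k} {xd : ι → complexBetti X d}
    (hx : ∀ i, IsRationalClass (x i)) (hxd : ∀ i, IsRationalClass (xd i)) :
    IsRationalClass (∑ i, cupProduct hkd (complexBetti.map (fst X X) k (P (x i)))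
        (complexBetti.map (snd X X) d (xd i))) := by
  classical
  refine isRationalClass_sum _ _ fun i _ ↦ ?_
  exact ((hPr _ (hx i)).pullback _).cup hkd ((hxd i).pullback _)

/-- Type `(dim X, dim X)` of the transposed graph-type class also for a dual family up to a scalar
`c ≠ 0` (the shape of the tree's `exists_rational_dual`). [cite: VoisinHodgeI2002, §11.3.3 Lemma 11.41] -/
theorem graphClassEndo_isOfHodgeType' (hX : IsSmoothProjective n X) {k d : ℕ} (hkd : k + d = 2 * n)
    (P : complexBetti X k →ₗ[ℂ] complexBetti X k)
    (hPt : ∀ (p q : ℕ) (y : complexBetti X k), IsOfHodgeType n X k p q y → IsOfHodgeType n X k p q (P y))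
    {ι : Type} [Fintype ι] [DecidableEq ι]
    (x : Module.Basis ι ℂ (complexBetti X k)) {xd : ι → complexBetti X d} (μ : OrientationFamily) {c : ℂ}
    (hc : c ≠ 0) (hd : ∀ i j, cupPairing (μ hX) hkd (x i) (xd j) = if i = j then c else 0) :
    IsOfHodgeType (n + n) (X ⊗ X) (2 * n) n n
      (∑ i, cupProduct hkd (complexBetti.map (fst X X) k (P (x i)))
        (complexBetti.map (snd X X) d (xd i))) := by
  have hd' : ∀ i j, cupPairing (μ hX) hkd (x i) (c⁻¹ • xd j) = if i = j then 1 else 0 := by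
    intro i j
    rw [map_smul, hd, smul_eq_mul]
    split_ifs
    · exact inv_mul_cancel₀ hc
    · exact mul_zero _
  obtain ⟨Q, hQ⟩ := graphClassEndo_isOfHodgeType hX hkd P hPt x μ hd'
  refine ⟨Q, ?_⟩
  have heq : (∑ i, cupProduct hkd (complexBetti.map (fst X X) k (P (x i)))
        (complexBetti.map (snd X X) d (xd i))) =
      c • ∑ i, cupProduct hkd (complexBetti.map (fst X X) k (P (x i)))
        (complexBetti.map (snd X X) d (c⁻¹ • xd i)) := by
    rw [Finset.smul_sum]
    refine Finset.sum_congr rfl fun i _ ↦ ?_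
    rw [map_smul, map_smul, smul_smul, mul_inv_cancel₀ hc, one_smul]
  rw [heq, map_smul]
  exact Submodule.smul_mem _ _ hQ

variable {g : ∀ k : ℕ, complexBetti X k ≃ₗ[ℂ] complexBetti X k}
  {G : ∀ a k : ℕ, complexBetti (cartesianPow X (a + 1)) k ≃ₗ[ℂ] complexBetti (cartesianPow X (a + 1)) k}

/-- **The Künneth extension of an element of the Hodge group commutes with every Hodge-structure
endomorphism `P` of `Hᵏ(X(ℂ); ℂ)`** (rational-class preserving and Hodge-type preserving):
`g_k (P y) = P (g_k y)` (Deligne–Milne I §3; on the carriers through the rational `(n,n)`-class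
`Σᵢ pr₁^* P xᵢ ∪ pr₂^* xdᵢ` on `X × X = X^{×2}`, fixed by `G₁`, the uniqueness of Künneth coefficients and
the isometry property `HodgeGroupExterior.cupPairing_apply_dual`; verbatim the tree's
`HodgeGroupExterior.kunneth_apply_map` at `a = 0` with `f^*` replaced by `P`).
[cite: Deligne1982HodgeCycles, I §3 Prop. 3.4 and the definition preceding it] [cite: VoisinHodgeI2002, §11.3.3 Lemma 11.41] -/
theorem kunneth_apply_hodgeEndo (hX : IsSmoothProjective n X) (hG : IsKunnethFamily X G) (h0 : G 0 = g)
    (hfix : ∀ (a p : ℕ), ∀ x ∈ hodgePowClasses n X a p, G a (2 * p) x = x)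
    (k : ℕ) (P : complexBetti X k →ₗ[ℂ] complexBetti X k)
    (hPr : ∀ y : complexBetti X k, IsRationalClass y → IsRationalClass (P y))
    (hPt : ∀ (p q : ℕ) (y : complexBetti X k), IsOfHodgeType n X k p q y → IsOfHodgeType n X k p q (P y))
    (y : complexBetti X k) :
    g k (P y) = P (g k y) := by
  classical
  by_cases hk : 2 * n < k
  · haveI := subsingleton_complexBetti hX hk
    exact Subsingleton.elim _ _
  obtain ⟨d, hkd⟩ : ∃ d, k + d = 2 * n := ⟨2 * n - k, by omega⟩
  let μ : OrientationFamily := complexOrientationFamily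
  obtain ⟨N, x, xd, c, hc, hxr, hxdr, hdual⟩ := exists_rational_dual μ hX hkd
  -- the transposed graph class on `X ⊗ X = X^{×2}` and its invariance
  set γ : complexBetti (cartesianPow X 2) (2 * n) :=
    ∑ i, cupProduct hkd (complexBetti.map (fst X X) k (P (x i)))
      (complexBetti.map (snd X X) d (xd i)) with hγ
  have hγmem : γ ∈ hodgePowClasses n X 1 n :=
    ⟨graphClassEndo_isRationalClass hkd P hPr hxr hxdr, graphClassEndo_isOfHodgeType' hX hkd P hPt x μ hc hdual⟩
  have hinv := hfix 1 n γ hγmem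
  have hcross : ∀ (i j k' : ℕ) (h : i + j = k') (u : complexBetti X i) (w : complexBetti X j),
      G 1 k' (cupProduct h (complexBetti.map (fst X X) i u) (complexBetti.map (snd X X) j w)) =
        cupProduct h (complexBetti.map (fst X X) i (g i u)) (complexBetti.map (snd X X) j (g j w)) := by
    intro i j k' h u w
    have := hG.map_cross 0 i j k' h u w
    rw [h0] at this
    exact this
  have hGγ : G 1 (2 * n) γ =
      ∑ i, cupProduct hkd (complexBetti.map (fst X X) k (g k (P (x i))))
        (complexBetti.map (snd X X) d (g d (xd i))) := by
    rw [hγ, map_sum]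
    exact Finset.sum_congr rfl fun i _ ↦ hcross k d (2 * n) hkd _ (xd i)
  rw [hGγ, hγ] at hinv
  -- normalised dual and expansion
  have hnorm : ∀ i j, cupPairing (μ hX) hkd (x i) (c⁻¹ • xd j) = if i = j then 1 else 0 := by
    intro i j
    rw [map_smul, hdual, smul_eq_mul]
    split_ifs
    · exact inv_mul_cancel₀ hc
    · exact mul_zero _
  have hexp : ∀ w : complexBetti X k, ∑ i, cupPairing (μ hX) hkd w (xd i) • x i = c • w := by
    intro w
    have h1 := PerfPairDuality.eq_sum_smul_self x hnorm w
    rw [h1, Finset.smul_sum]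
    conv_lhs => rw [← h1]
    refine Finset.sum_congr rfl fun i _ ↦ ?_
    rw [map_smul, smul_eq_mul, smul_smul, mul_inv_cancel_left₀ hc]
  -- extract with the functional `⟨g y, ·⟩`
  have h := HodgeGroupExterior.sum_smul_eq_of_sum_cross_eq hX hX hkd (by omega)
    (fun i ↦ g k (P (x i))) (fun i ↦ P (x i))
    (fun i ↦ g d (xd i)) (fun i ↦ xd i) hinv (cupPairing (μ hX) hkd (g k y))
  -- RHS: `Σ ⟨g y, xd_i⟩ P x_i = c • P (g y)`
  have hR : ∑ i, cupPairing (μ hX) hkd (g k y) (xd i) • P (x i) = c • P (g k y) := by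
    rw [← map_smul, ← hexp (g k y), map_sum]
    simp_rw [map_smul]
  -- LHS: `Σ ⟨g y, g xd_i⟩ g P x_i = Σ ⟨y, xd_i⟩ g P x_i = c • g (P y)`
  have hL : ∑ i, cupPairing (μ hX) hkd (g k y) (g d (xd i)) • g k (P (x i)) = c • g k (P y) := by
    simp_rw [HodgeGroupExterior.cupPairing_apply_dual hX hG h0 hfix hkd x μ hc hxr hxdr hdual (g k y)]
    rw [LinearEquiv.symm_apply_apply, ← map_smul, ← map_smul, ← hexp y, map_sum, map_sum]
    simp_rw [map_smul]
  have h' : c • g k (P y) = c • P (g k y) := by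
    rw [← hL, ← hR]; exact h
  exact smul_right_injective _ hc h'

/-- **An element of the Hodge group commutes with every Hodge-structure endomorphism of
`Hᵏ(X(ℂ); ℂ)`** (rational-class and Hodge-type preserving `ℂ`-linear `P`): `g_k ∘ P = P ∘ g_k` for
`g ∈ Hg(X)(ℂ)` (the tree's Tannaka-free `hodgeGroup n X`). [cite: Deligne1982HodgeCycles, I §3 Prop. 3.4 and the definition preceding it]
[cite: VoisinHodgeI2002, §11.3.3 Lemma 11.41] -/
theorem hodgeGroup_apply_hodgeEndo (hX : IsSmoothProjective n X) (hg : g ∈ hodgeGroup n X) (k : ℕ)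
    (P : complexBetti X k →ₗ[ℂ] complexBetti X k)
    (hPr : ∀ y : complexBetti X k, IsRationalClass y → IsRationalClass (P y))
    (hPt : ∀ (p q : ℕ) (y : complexBetti X k), IsOfHodgeType n X k p q y → IsOfHodgeType n X k p q (P y))
    (y : complexBetti X k) : g k (P y) = P (g k y) := by
  obtain ⟨G, hG, h0, hfix⟩ := hg
  exact kunneth_apply_hodgeEndo hX hG h0 hfix k P hPr hPt y

/-- **The range of a Hodge-structure endomorphism is stable under the Hodge group**: for `P` as above
and `g ∈ Hg(X)(ℂ)`, `g_k` maps `range P` into itself (`g_k (P y) = P (g_k y)`). In particular a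
sub-Hodge structure that is the image of a rational Hodge-type-preserving projector is `Hg`-stable
(Deligne–Milne I §3). [cite: Deligne1982HodgeCycles, I §3 Prop. 3.4] -/
theorem hodgeGroup_apply_mem_range_hodgeEndo (hX : IsSmoothProjective n X) (hg : g ∈ hodgeGroup n X) (k : ℕ)
    (P : complexBetti X k →ₗ[ℂ] complexBetti X k)
    (hPr : ∀ y : complexBetti X k, IsRationalClass y → IsRationalClass (P y))
    (hPt : ∀ (p q : ℕ) (y : complexBetti X k), IsOfHodgeType n X k p q y → IsOfHodgeType n X k p q (P y))
    {z : complexBetti X k} (hz : z ∈ LinearMap.range P) : g k z ∈ LinearMap.range P := by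
  obtain ⟨y, rfl⟩ := hz
  rw [hodgeGroup_apply_hodgeEndo hX hg k P hPr hPt y]
  exact LinearMap.mem_range_self P _

end Summit.HodgeConjecture.HodgeConjecture.Theorems.CYFormSquare

end
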